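/-
Origin: expansion seat `literature-prover-pub-hodgecm-cf-hasseminkowski-g6-0`, handover #1(c) v3 2026-08-18T07:52:35Z (`HOME/pub-hodgecm-cf-hasseminkowski-g6/handover/HodgeCM/Literature/QuadraticCharacterCM.lean`, md5 6133bc89, 344 lines);
landed by the gen-7 packager in gate run 26 as `HodgeCM/Literature/QuadraticCharacterCM.lean` (verbatim).
-/
/-
Origin: CITED-FACT seat (4), unit `pub-hodgecm-cf-hasseminkowski-g6` (session literature-prover-pub-hodgecm-cf-hasseminkowski-g6-0),
HodgeCM publication cell, 2026-08-18.  Intended landing: `HodgeCM/Literature/QuadraticCharacterCM.lean` (after `QuadraticCharacter.lean`).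
-/
import Summits.HodgeConjecture.HodgeCM.Literature.QuadraticCharacter_2

/-!
# `ε_{L/L⁺}` for a CM field and N15 with NO input

For a CM field `L` (Mathlib `IsCMField L`: totally complex quadratic extension of its maximal real
subfield `L⁺`), this file builds the quadratic character `ε_{L/L⁺} : C_{L⁺} → S¹` of
`QuadraticCharacter.lean` and closes node N15 of PerL v5 (§3.2, tex ll. 304–313) outright:

* `NumberField.IsCMField.exists_totallyNegative_generator` — there is `a ∈ L⁺`, not a square in `L⁺`,
  with `L = L⁺(√a)` (some `α ∈ L`, `α² = a`, `ᾱ = -α`) and `σ_v(a) < 0` at every (real) place `v` of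
  `L⁺` (take `α = x - x̄` for any `x ∉ L⁺`; `φ(α)` is purely imaginary for every `φ : L → ℂ`);
* `NumberField.quadraticCharacterCM L : IdeleClassGroup L⁺ →* Circle` — `ε_{L/L⁺}`, continuous
  (`continuous_quadraticCharacterCM`), of order `2`, trivial exactly on `L⁺^× · N J` where `N J` is
  O'Meara's group of idèles of `L⁺` that are local norms from `L⁺_v(√a) = L_w` everywhere
  (`quadraticCharacterCM_mk_eq_one_iff`), and of archimedean type `sgn` at every real place
  (`quadraticCharacterCM_infUnitsToClass_zpow`: `ε(y)^m = ∏_v (y_v/|y_v|)^m` on `(L⁺_∞)^×`);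
* **`NumberField.exists_unitaryHeckeCharacter_of_isCMField_zpow`** — N15 with NO INPUT: for every
  integer `m` and every infinity type `e = (m_b)` with `m_b ≡ m (mod 2)` there is a unitary Hecke
  character `ψ` of `L` with components `(z/|z|)^{m_b}` at the complex places and `ψ ∘ ι = ε^m_{L/L⁺}` on
  `C_{L⁺}` (PerL tex ll. 305–307 verbatim: "unitary Hecke characters of `L` with prescribed components
  `(z/|z|)^{m_b}` at the complex places and prescribed restriction `ε^m_{L/L_0}` to `𝔸^×_{L_0}`, all
  `m_b ≡ m mod 2`, exist"); `…_of_odd` is the odd case with `ψ ∘ ι = ε_{L/L⁺}`.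

* `quadraticCharacterCM_ne_one` / `quadraticCharacterCM_sq` — `ε ≠ 1`, `ε² = 1` (order exactly `2`);
  `quadraticCharacterCM_canonical` — `ε` is the quadratic character of EVERY presentation `L = L⁺(√a')`
  (the choice `cmGenerator` is immaterial); `exists_splittingCharacters` — tex ll. 305–314 literally
  (`μ_W, μ_1, μ_2 = μ_W μ_1⁻¹, μ_3, μ_4 = μ_W μ_3⁻¹`); `exists_chiV` (l. 259), `exists_mu_restrict_pow`
  (ll. 261–262).

It is gen-5's `exists_unitaryHeckeCharacter_of_isCMField_parity` (`ClassBaseChangeParity.lean`, whose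
only input was the character `χA = ε^m`) fed with the kernel construction of `ε`.  Inputs that are
published theorems, all compiled in this package as vendored kernel source: O'Meara 65:21 (norm index
`2`), 71:18 (Hilbert reciprocity), 63:1b/63:16 (local squares and units are norms), and — through
pv10's chain and gen-5's files — Cassels–Fröhlich II §16 (`C¹` compact).  No PerL/QW8/2001 statement is
used; no named fact is introduced.
-/

set_option autoImplicit false

noncomputable section

open NumberField InfinitePlace NumberField.InfinitePlace.Completion IsDedekindDomain
open Literature.NumberTheory.QuadraticForms
open scoped ComplexConjugate

namespace NumberField

variable (L : Type) [Field L] [NumberField L] [IsCMField L]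

namespace IsCMField

/-- **A CM field is `L⁺(√a)` with `a` totally negative.**  There is `a ∈ L⁺` which is not a square in
`L⁺`, is `α²` for some `α ∈ L` with `ᾱ = -α`, and has `σ_v(a) < 0` at every real place `v` of `L⁺`. -/
theorem exists_totallyNegative_generator :
    ∃ a : maximalRealSubfield L, ¬ IsSquare a ∧ (∃ α : L, α ≠ 0 ∧ α ^ 2 = (a : L) ∧ complexConj L α = -α) ∧
      ∀ (v : InfinitePlace (maximalRealSubfield L)) (hv : v.IsReal), embedding_of_isReal hv a < 0 := by
  -- some `x ∉ L⁺`, and `α = x - x̄`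
  obtain ⟨x, hx⟩ : ∃ x : L, complexConj L x ≠ x := by
    by_contra h
    push Not at h
    exact complexConj_ne_one L (AlgEquiv.ext h)
  set α : L := x - complexConj L x with hαdef
  have hcα : complexConj L α = -α := by
    rw [hαdef, map_sub, complexConj_apply_apply, neg_sub]
  have hα0 : α ≠ 0 := by
    intro h
    rw [hαdef, sub_eq_zero] at h
    exact hx h.symm
  have hmem : α ^ 2 ∈ maximalRealSubfield L := by
    rw [← complexConj_eq_self_iff, map_pow, hcα, neg_sq]
  refine ⟨⟨α ^ 2, hmem⟩, ?_, ⟨α, hα0, rfl, hcα⟩, fun v hv => ?_⟩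
  · -- not a square in `L⁺`: else `α = ± b ∈ L⁺`, `ᾱ = α = -α`, `α = 0`
    rintro ⟨b, hb⟩
    have hb' : α ^ 2 = (b : L) ^ 2 := by
      have := congrArg (fun z : maximalRealSubfield L => (z : L)) hb
      simpa [sq] using this
    have hαK : α ∈ maximalRealSubfield L := by
      rcases sq_eq_sq_iff_eq_or_eq_neg.1 hb' with h | h
      · rw [h]; exact b.2
      · rw [h]; exact neg_mem b.2
    have hfix : complexConj L α = α := (complexConj_eq_self_iff L α).2 hαK
    rw [hcα] at hfix
    have h2 : (2 : L) * α = 0 := by linear_combination -hfix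
    exact hα0 ((mul_eq_zero.1 h2).resolve_left two_ne_zero)
  · -- negativity at the real place `v`: `σ_v(a) = φ(α)²` with `φ(α)` purely imaginary and non-zero
    obtain ⟨w, hw⟩ := comap_surjective (K := L) (k := maximalRealSubfield L) v
    have hemb : (v.embedding : maximalRealSubfield L →+* ℂ) =
        w.embedding.comp (algebraMap (maximalRealSubfield L) L) := by
      subst hw
      exact comap_embedding_of_isReal _ hv
    set z : ℂ := w.embedding α with hzdef
    have hz : conj z = -z := by
      rw [hzdef, ← complexEmbedding_complexConj, hcα, map_neg]
    have hre : z.re = 0 := by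
      have h := congrArg Complex.re hz
      rw [Complex.conj_re, Complex.neg_re] at h
      linarith
    have hz0 : z ≠ 0 := by
      rw [hzdef]
      exact (map_ne_zero_iff _ w.embedding.injective).2 hα0
    have him : z.im ≠ 0 := fun h => hz0 (Complex.ext hre h)
    have hval : ((embedding_of_isReal hv ⟨α ^ 2, hmem⟩ : ℝ) : ℂ) = z ^ 2 := by
      rw [embedding_of_isReal_apply, hemb, RingHom.comp_apply, hzdef, ← map_pow]
      rfl
    have hre2 : (z ^ 2).re = -(z.im ^ 2) := by
      rw [sq, Complex.mul_re, hre]; ring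
    have : embedding_of_isReal hv ⟨α ^ 2, hmem⟩ = (z ^ 2).re := by
      rw [← hval, Complex.ofReal_re]
    rw [this, hre2, neg_lt_zero]
    positivity

end IsCMField

/-! ## `ε_{L/L⁺}` -/

/-- A totally negative non-square `a ∈ L⁺` with `L = L⁺(√a)` (a choice; the character below does not
depend on it, its kernel being `L⁺^× N_{L/L⁺} J`). -/
def cmGenerator : maximalRealSubfield L :=
  (IsCMField.exists_totallyNegative_generator L).choose

/-- (Ported verbatim from the HodgeCMPerL package; no docstring in the source.) -/
theorem cmGenerator_not_isSquare : ¬ IsSquare (cmGenerator L) :=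
  (IsCMField.exists_totallyNegative_generator L).choose_spec.1

/-- (Ported verbatim from the HodgeCMPerL package; no docstring in the source.) -/
theorem cmGenerator_exists_sqrt :
    ∃ α : L, α ≠ 0 ∧ α ^ 2 = (cmGenerator L : L) ∧ IsCMField.complexConj L α = -α :=
  (IsCMField.exists_totallyNegative_generator L).choose_spec.2.1

/-- (Ported verbatim from the HodgeCMPerL package; no docstring in the source.) -/
theorem cmGenerator_neg (v : InfinitePlace (maximalRealSubfield L)) (hv : v.IsReal) :
    embedding_of_isReal hv (cmGenerator L) < 0 :=
  (IsCMField.exists_totallyNegative_generator L).choose_spec.2.2 v hv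

/-- **The quadratic character `ε_{L/L⁺} : C_{L⁺} → S¹` of the CM extension `L/L⁺`** (kernel
`L⁺^× · N_{L/L⁺} J`, O'Meara §65; PerL v5 §3.2 l. 307 `ε_{L/L_0}`). -/
def quadraticCharacterCM : IdeleClassGroup (maximalRealSubfield L) →* Circle :=
  quadraticCharacter (cmGenerator_not_isSquare L)

/-- (Ported verbatim from the HodgeCMPerL package; no docstring in the source.) -/
theorem quadraticCharacterCM_def :
    quadraticCharacterCM L = quadraticCharacter (cmGenerator_not_isSquare L) := rfl

/-- `ε_{L/L⁺}` is continuous. -/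
theorem continuous_quadraticCharacterCM : Continuous (quadraticCharacterCM L) :=
  continuous_quadraticCharacter _

/-- `ε_{L/L⁺}² = 1`. -/
theorem quadraticCharacterCM_sq (c : IdeleClassGroup (maximalRealSubfield L)) : quadraticCharacterCM L c ^ 2 = 1 :=
  quadraticCharacter_sq _ c

/-- **`ε_{L/L⁺} ≠ 1`**: it takes the value `-1` on the class of the idèle `(-1)_v` at any real place `v`
of `L⁺`. -/
theorem quadraticCharacterCM_ne_one : quadraticCharacterCM L ≠ 1 := by
  classical
  obtain ⟨v⟩ : Nonempty (InfinitePlace (maximalRealSubfield L)) := inferInstance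
  have hv : v.IsReal := IsTotallyReal.isReal v
  intro h
  have h1 := quadraticCharacter_single_of_isReal (cmGenerator_not_isSquare L) hv (cmGenerator_neg L v hv)
    (-1 : (v.Completion)ˣ)
  have hneg : ¬ 0 < ringEquivRealOfIsReal hv (((-1 : (v.Completion)ˣ) : v.Completion)) := by
    rw [Units.val_neg, Units.val_one, map_neg, map_one]
    norm_num
  rw [if_neg hneg, ← quadraticCharacterCM_def, h, MonoidHom.one_apply] at h1
  exact Circle.neg_ne_self 1 h1.symm

/-- `ε_{L/L⁺}` vanishes exactly on `L⁺^× · N J`, `N J` = the idèles of `L⁺` that are local norms from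
`L⁺_v(√a)` at every place (O'Meara's `N_{L/L⁺} J_L`, §65A Example 65:2). -/
theorem quadraticCharacterCM_mk_eq_one_iff (x : ideleGroup (maximalRealSubfield L)) :
    quadraticCharacterCM L (QuotientGroup.mk x) = 1 ↔ x ∈ quadraticNormGroup (maximalRealSubfield L) (cmGenerator L) :=
  quadraticCharacter_mk_eq_one_iff _ x

/-- **`ε_{L/L⁺}` has archimedean type `sgn`**: `ε(y)^m = ∏_v (y_v/|y_v|)^m` for `y ∈ (L⁺_∞)^×`. -/
theorem quadraticCharacterCM_infUnitsToClass_zpow (m : ℤ) (y : (InfiniteAdeleRing (maximalRealSubfield L))ˣ) :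
    quadraticCharacterCM L (infUnitsToClass (maximalRealSubfield L) y) ^ m =
      infinityTypeChar (maximalRealSubfield L) (fun _ => m) y :=
  quadraticCharacter_infUnitsToClass_zpow _ (fun v => IsTotallyReal.isReal v) (cmGenerator_neg L) m y

/-! ## N15 with no input -/

/-- **N15 (PerL v5 §3.2, tex ll. 304–313), NO INPUT.**  For a CM field `L`, an integer `m` and an
infinity type `e = (m_b)_b` with `m_b ≡ m (mod 2)`, there is a unitary Hecke character `ψ` of `L` with
components `(z/|z|)^{m_b}` at the complex places whose restriction to `C_{L⁺}` (along the adelic base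
change `ι = classBaseChange L⁺ L`) is `ε^m_{L/L⁺}`. -/
theorem exists_unitaryHeckeCharacter_of_isCMField_zpow (m : ℤ) (e : InfinitePlace L → ℤ)
    (he : ∀ w, e w ≡ m [ZMOD 2]) :
    ∃ ψ : UnitaryHeckeCharacter L, ψ.HasInfinityType L e ∧
      ∀ a, ψ (classBaseChange (maximalRealSubfield L) L a) = quadraticCharacterCM L a ^ m :=
  exists_unitaryHeckeCharacter_of_isCMField_parity L m e he
    ((zpowGroupHom m).comp (quadraticCharacterCM L))
    ((continuous_zpow m).comp (continuous_quadraticCharacterCM L))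
    (fun y => quadraticCharacterCM_infUnitsToClass_zpow L m y)

/-- **N15, odd `m`**: `ψ ∘ ι = ε_{L/L⁺}` itself (`ε^m = ε` for `m` odd). -/
theorem exists_unitaryHeckeCharacter_of_isCMField_odd {m : ℤ} (hm : Odd m) (e : InfinitePlace L → ℤ)
    (he : ∀ w, e w ≡ m [ZMOD 2]) :
    ∃ ψ : UnitaryHeckeCharacter L, ψ.HasInfinityType L e ∧
      ∀ a, ψ (classBaseChange (maximalRealSubfield L) L a) = quadraticCharacterCM L a := by
  obtain ⟨ψ, hψ, hψA⟩ := exists_unitaryHeckeCharacter_of_isCMField_zpow L m e he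
  refine ⟨ψ, hψ, fun a => ?_⟩
  rw [hψA a]
  obtain ⟨k, rfl⟩ := hm
  rw [zpow_add, zpow_mul, zpow_ofNat, quadraticCharacterCM_sq, one_zpow, one_mul, zpow_one]


/-! ## Canonicity: `ε_{L/L⁺}` is the quadratic character of ANY `a'` with `L = L⁺(√a')` -/

/-- In a CM field, a square root `β ∈ L` of a non-square `a' ∈ L⁺` is anti-invariant: `β̄ = -β`. -/
theorem IsCMField.complexConj_sqrt_eq_neg {a' : maximalRealSubfield L} (ha' : ¬ IsSquare a') {β : L}
    (hβ : β ^ 2 = (a' : L)) : IsCMField.complexConj L β = -β := by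
  have hsq : (IsCMField.complexConj L β) ^ 2 = β ^ 2 := by
    rw [← map_pow, hβ, IsCMField.complexConj_apply_eq_self]
  rcases sq_eq_sq_iff_eq_or_eq_neg.1 hsq with h | h
  · -- `β ∈ L⁺` would make `a'` a square in `L⁺`
    exfalso
    have hβK : β ∈ maximalRealSubfield L := (IsCMField.complexConj_eq_self_iff L β).1 h
    refine ha' ⟨⟨β, hβK⟩, Subtype.ext ?_⟩
    show (a' : L) = β * β
    rw [← hβ, sq]
  · exact h

/-- **Canonicity of `ε_{L/L⁺}`.**  For every `a' ∈ L⁺` which is not a square in `L⁺` but is a square in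
`L` (i.e. `L = L⁺(√a')`), the quadratic character of `L⁺(√a')/L⁺` is `quadraticCharacterCM L`: the
choice `cmGenerator L` is immaterial (`a' = a·q²` with `q = β/α ∈ L⁺`, and `ε` only depends on the square
class, `quadraticCharacter_eq_of_eq_mul_sq`). -/
theorem quadraticCharacterCM_canonical {a' : maximalRealSubfield L} (ha' : ¬ IsSquare a')
    (hL : IsSquare (a' : L)) : quadraticCharacter ha' = quadraticCharacterCM L := by
  obtain ⟨β, hβ⟩ := hL
  have hβ2 : β ^ 2 = (a' : L) := by rw [hβ, sq]
  obtain ⟨α, hα0, hα2, hcα⟩ := cmGenerator_exists_sqrt L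
  have hcβ : IsCMField.complexConj L β = -β := IsCMField.complexConj_sqrt_eq_neg L ha' hβ2
  -- `q = β / α` is fixed by complex conjugation, hence lies in `L⁺`
  have hqK : β / α ∈ maximalRealSubfield L := by
    rw [← IsCMField.complexConj_eq_self_iff, map_div₀, hcβ, hcα, neg_div_neg_eq]
  have hβ0 : β ≠ 0 := by
    rintro rfl
    apply ha'
    have : (a' : L) = 0 := by rw [← hβ2]; ring
    rw [show a' = 0 from Subtype.ext this]
    exact IsSquare.zero
  have hq0 : (⟨β / α, hqK⟩ : maximalRealSubfield L) ≠ 0 := by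
    intro h
    have := congrArg (fun z : maximalRealSubfield L => (z : L)) h
    simp only [ZeroMemClass.coe_zero, div_eq_zero_iff] at this
    rcases this with h1 | h1
    · exact hβ0 h1
    · exact hα0 h1
  refine quadraticCharacter_eq_of_eq_mul_sq (cmGenerator_not_isSquare L) ha' (b := ⟨β / α, hqK⟩) hq0
    (Subtype.ext ?_)
  show (a' : L) = (cmGenerator L : L) * (β / α) ^ 2
  rw [← hβ2, ← hα2]
  field_simp


/-! ## The five splitting characters of PerL §3.2 (tex ll. 305–314) -/

section Splitting

variable {L}

omit [IsCMField L] in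
/-- (Ported verbatim from the HodgeCMPerL package; no docstring in the source.) -/
theorem infinityTypeChar_add (e e' : InfinitePlace L → ℤ) (u : (InfiniteAdeleRing L)ˣ) :
    infinityTypeChar L (e + e') u = infinityTypeChar L e u * infinityTypeChar L e' u := by
  simp only [infinityTypeChar_apply, Pi.add_apply, zpow_add, Finset.prod_mul_distrib]

omit [IsCMField L] in
/-- (Ported verbatim from the HodgeCMPerL package; no docstring in the source.) -/
theorem infinityTypeChar_neg (e : InfinitePlace L → ℤ) (u : (InfiniteAdeleRing L)ˣ) :
    infinityTypeChar L (-e) u = (infinityTypeChar L e u)⁻¹ := by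
  simp only [infinityTypeChar_apply, Pi.neg_apply, zpow_neg, Finset.prod_inv_distrib]

omit [IsCMField L] in
/-- (Ported verbatim from the HodgeCMPerL package; no docstring in the source.) -/
theorem UnitaryHeckeCharacter.inv_apply (ψ : UnitaryHeckeCharacter L) (c : IdeleClassGroup L) :
    (ψ⁻¹) c = (ψ c)⁻¹ := rfl

omit [IsCMField L] in
/-- ∞-types add under products of unitary Hecke characters. -/
theorem UnitaryHeckeCharacter.HasInfinityType.mul {ψ φ : UnitaryHeckeCharacter L} {e e' : InfinitePlace L → ℤ}
    (hψ : ψ.HasInfinityType L e) (hφ : φ.HasInfinityType L e') : (ψ * φ).HasInfinityType L (e + e') :=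
  fun u => by rw [ContinuousMonoidHom.mul_apply, hψ u, hφ u, infinityTypeChar_add]

omit [IsCMField L] in
/-- ∞-types negate under inversion. -/
theorem UnitaryHeckeCharacter.HasInfinityType.inv {ψ : UnitaryHeckeCharacter L} {e : InfinitePlace L → ℤ}
    (hψ : ψ.HasInfinityType L e) : (ψ⁻¹).HasInfinityType L (-e) :=
  fun u => by rw [UnitaryHeckeCharacter.inv_apply, hψ u, infinityTypeChar_neg]

variable (L)

/-- **PerL v5 §3.2, tex ll. 305–314 — the splitting characters, NO input.**  "fix splitting characters
`μ_1, …, μ_4` of the prescribed infinity types with `μ_1 μ_2 = μ_3 μ_4 = μ_W` (unitary Hecke characters of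
`L` with prescribed components `(z/|z|)^{m_b}` at the complex places and prescribed restriction
`ε^m_{L/L_0}` to `𝔸^×_{L_0}`, all `m_b ≡ m mod 2`, exist … take `μ_1, μ_3, μ_W` this way and put
`μ_2 := μ_W μ_1^{-1}`, `μ_4 := μ_W μ_3^{-1}`)."  For any prescribed data `(m_W, e_W)`, `(m_1, e_1)`,
`(m_3, e_3)` satisfying the parity condition there are unitary Hecke characters `μ_W, μ_1, μ_2, μ_3, μ_4`
of `L` of infinity types `e_W, e_1, e_W - e_1, e_3, e_W - e_3`, with restrictions
`ε^{m_W}, ε^{m_1}, ε^{m_W - m_1}, ε^{m_3}, ε^{m_W - m_3}` along `ι : C_{L⁺} → C_L`, and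
`μ_1 μ_2 = μ_3 μ_4 = μ_W`. -/
theorem exists_splittingCharacters (mW m₁ m₃ : ℤ) (eW e₁ e₃ : InfinitePlace L → ℤ)
    (hW : ∀ w, eW w ≡ mW [ZMOD 2]) (h₁ : ∀ w, e₁ w ≡ m₁ [ZMOD 2]) (h₃ : ∀ w, e₃ w ≡ m₃ [ZMOD 2]) :
    ∃ μW μ₁ μ₂ μ₃ μ₄ : UnitaryHeckeCharacter L,
      μW.HasInfinityType L eW ∧ μ₁.HasInfinityType L e₁ ∧ μ₂.HasInfinityType L (eW - e₁) ∧
      μ₃.HasInfinityType L e₃ ∧ μ₄.HasInfinityType L (eW - e₃) ∧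
      (∀ a, μW (classBaseChange (maximalRealSubfield L) L a) = quadraticCharacterCM L a ^ mW) ∧
      (∀ a, μ₁ (classBaseChange (maximalRealSubfield L) L a) = quadraticCharacterCM L a ^ m₁) ∧
      (∀ a, μ₂ (classBaseChange (maximalRealSubfield L) L a) = quadraticCharacterCM L a ^ (mW - m₁)) ∧
      (∀ a, μ₃ (classBaseChange (maximalRealSubfield L) L a) = quadraticCharacterCM L a ^ m₃) ∧
      (∀ a, μ₄ (classBaseChange (maximalRealSubfield L) L a) = quadraticCharacterCM L a ^ (mW - m₃)) ∧
      μ₁ * μ₂ = μW ∧ μ₃ * μ₄ = μW := by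
  obtain ⟨μW, hWt, hWr⟩ := exists_unitaryHeckeCharacter_of_isCMField_zpow L mW eW hW
  obtain ⟨μ₁, h₁t, h₁r⟩ := exists_unitaryHeckeCharacter_of_isCMField_zpow L m₁ e₁ h₁
  obtain ⟨μ₃, h₃t, h₃r⟩ := exists_unitaryHeckeCharacter_of_isCMField_zpow L m₃ e₃ h₃
  refine ⟨μW, μ₁, μW * μ₁⁻¹, μ₃, μW * μ₃⁻¹, hWt, h₁t, ?_, h₃t, ?_, hWr, h₁r, fun a => ?_, h₃r,
    fun a => ?_, ?_, ?_⟩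
  · rw [sub_eq_add_neg]; exact hWt.mul h₁t.inv
  · rw [sub_eq_add_neg]; exact hWt.mul h₃t.inv
  · rw [ContinuousMonoidHom.mul_apply, UnitaryHeckeCharacter.inv_apply, hWr a, h₁r a, zpow_sub]
  · rw [ContinuousMonoidHom.mul_apply, UnitaryHeckeCharacter.inv_apply, hWr a, h₃r a, zpow_sub]
  · rw [mul_comm, inv_mul_cancel_right]
  · rw [mul_comm, inv_mul_cancel_right]

end Splitting


/-! ## PerL §3.2 l. 259: the `U(W)`-side splitting character `χ_V` -/

/-- **PerL v5 tex ll. 258–259, NO input**: "a unitary Hecke character `χ_V` of `L` with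
`χ_V|_{𝔸^×_{L_0}} = ε_{L/L_0}`" exists — e.g. of infinity type `(1, …, 1)` (any all-odd type works,
`exists_unitaryHeckeCharacter_of_isCMField_odd`). -/
theorem exists_chiV : ∃ χ : UnitaryHeckeCharacter L, χ.HasInfinityType L (fun _ => 1) ∧
    ∀ a, χ (classBaseChange (maximalRealSubfield L) L a) = quadraticCharacterCM L a :=
  exists_unitaryHeckeCharacter_of_isCMField_odd L (m := 1) odd_one _ fun _ => Int.ModEq.refl 1

/-- **PerL v5 tex ll. 261–262, NO input**: for every `n` (= `dim W`) a unitary Hecke character `μ` of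
`L` with `μ|_{𝔸^×_{L_0}} = ε^n_{L/L_0}` exists (of infinity type `(n, …, n)`, say). -/
theorem exists_mu_restrict_pow (n : ℕ) : ∃ μ : UnitaryHeckeCharacter L, μ.HasInfinityType L (fun _ => (n : ℤ)) ∧
    ∀ a, μ (classBaseChange (maximalRealSubfield L) L a) = quadraticCharacterCM L a ^ n := by
  obtain ⟨μ, hμ, hμA⟩ := exists_unitaryHeckeCharacter_of_isCMField_zpow L (n : ℤ) (fun _ => (n : ℤ))
    fun _ => Int.ModEq.refl _
  exact ⟨μ, hμ, fun a => by rw [hμA a, zpow_natCast]⟩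

end NumberField

end
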